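import Literature.AlgebraicGeometry.Motives.MixedHodgeStructureDeligneSplittingUnique
import Literature.AlgebraicGeometry.Motives.MixedHodgeStructureDual
import HarnessLib

/-!
# Deligne's splitting of the dual mixed Hodge structure: `I^{p,q}(V^∨) = (⊕_{(r,s) ≠ (-p,-q)} I^{r,s})^⊥`

Deligne's bigrading `I^{p,q}` of a mixed Hodge structure is "compatible with morphisms of MHS and with
the basic operators of tensor, dual, sub, and quotient" (Green–Griffiths–Kerr, Prop. (I.C.2) (ii);
Cattani–El Zein–Griffiths–Lê, Thm. 7.5.6 "compatible with all morphisms", §3.2.2.7 for the dual MHS).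
This file proves the DUAL case for the tree's dual mixed Hodge structure `H.dual` on `V^∨`
(`W_r(V^∨) = (W_{-r-1})^⊥`, `F^p(V^∨) = (F^{1-p})^⊥`, `Motives/MixedHodgeStructureDual`):

* §1 (private) `biSup_dualAnnihilator_biSup_ne_eq` — the DUAL DECOMPOSITION of an internal direct sum: for an
  independent family `I` with finite support spanning `M` and any index set `S`,
  `Σ_{i ∈ S} (⊕_{j ≠ i} I_j)^⊥ = (⊕_{j ∉ S} I_j)^⊥` (projections along complements).
* §2 transport along the comparison `dualBaseChange V : ℂ ⊗ V^∨ ⥲ (ℂ ⊗ V)^∨`.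
* §3 the dual bigrading `dualBigrading H (p,q) := (⊕_{(r,s) ≠ (-p,-q)} I^{r,s}(V))^⊥`; it splits
  `W(V^∨)` and `F(V^∨)` (`baseChange_dual_W_eq_biSup_dualBigrading`, `dual_F_eq_biSup_dualBigrading`) and
  satisfies the congruence (7.5.11) (`complexConj_dualBigrading_le`, DUAL to the congruence for `I(V)`,
  the tree's `complexConj_deligneI_le_deligneI_sup_biSup`); hence, by the UNIQUENESS of Deligne's
  splitting (`eq_deligneI_of_splitting`), **`dual_deligneI : I^{p,q}(V^∨) = (⊕_{(r,s) ≠ (-p,-q)} I^{r,s})^⊥`**,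
  with the membership form `mem_dual_deligneI_iff` / `dualBaseChange_apply_eq_zero_of_mem_deligneI`
  (`I^{p,q}(V^∨)` pairs trivially with `I^{r,s}(V)` unless `(r,s) = (-p,-q)`) and
  `complexConj_dual_deligneI_of_forall` (the dual of an `ℝ`-split MHS is `ℝ`-split).

Everything is proved; no named fact is introduced.

## References

* [GreenGriffithsKerr2012] M. Green, P. Griffiths, M. Kerr, *Mumford–Tate groups and domains*, Ann. of
  Math. Stud. 183 (2012), Prop. (I.C.2) (i)–(ii).
* [CattaniElZeinGriffithsLe2014] E. Cattani et al. (eds.), *Hodge Theory*, Math. Notes 49 (2014),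
  Thm. 7.5.6 (7.5.11), Def. 7.5.7, §3.2.2.7.
* [DeligneHodgeII1971] P. Deligne, Théorie de Hodge II, 1.1.7, 1.2.8.
-/

noncomputable section

open scoped TensorProduct

namespace Literature.AlgebraicGeometry.Motives

namespace MixedHodgeStructure

open HodgeStructure (complexConj complexConj_complexConj complexConj_mono dualBaseChange dualBaseChange_bijective)

universe u

/-! ## §1 The dual decomposition of an internal direct sum -/

section DualDecomposition

variable {ι : Type*} {M : Type*} [AddCommGroup M] [Module ℂ M] {I : ι → Submodule ℂ M}

/-- For an independent family spanning `M`, each `I i` is complementary to the sum of the others. [folklore] -/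
private theorem isCompl_biSup_ne (hI : iSupIndep I) (htop : ⨆ i, I i = ⊤) (i : ι) :
    IsCompl (I i) (⨆ j ∈ {j | j ≠ i}, I j) :=
  ⟨hI i, by
    rw [codisjoint_iff, ← htop, iSup_split_single I i]
    rfl⟩

/-- **Dual decomposition of an internal direct sum**: for an independent family `I` with finite support
spanning `M` and any index set `S`, the "dual pieces" `(⊕_{j ≠ i} I_j)^⊥` (`i ∈ S`) span the annihilator
of `⊕_{j ∉ S} I_j`: `Σ_{i ∈ S} (⊕_{j ≠ i} I_j)^⊥ = (⊕_{j ∉ S} I_j)^⊥` (linear algebra; private helper).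
[folklore] -/
private theorem biSup_dualAnnihilator_biSup_ne_eq (hI : iSupIndep I) (htop : ⨆ i, I i = ⊤)
    (hfin : {i | I i ≠ ⊥}.Finite) (S : Set ι) :
    ⨆ i ∈ S, (⨆ j ∈ {j | j ≠ i}, I j).dualAnnihilator = (⨆ j ∈ Sᶜ, I j).dualAnnihilator := by
  classical
  refine le_antisymm (iSup₂_le fun i hi => Submodule.dualAnnihilator_anti
    (biSup_mono fun j (hj : j ∈ Sᶜ) => fun h => hj (h ▸ hi))) fun φ hφ => ?_
  -- the projections onto the pieces
  have hc : ∀ i, IsCompl (I i) (⨆ j ∈ {j | j ≠ i}, I j) := isCompl_biSup_ne hI htop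
  set P : ι → M →ₗ[ℂ] M := fun i => (I i).projection (⨆ j ∈ {j | j ≠ i}, I j) (hc i) with hP
  have hP_self : ∀ {t : ι} {x : M}, x ∈ I t → P t x = x := fun {t x} hx =>
    Submodule.projection_apply_of_mem_left (hc t) hx
  have hP_ne : ∀ {t i : ι} {x : M}, x ∈ I t → i ≠ t → P i x = 0 := fun {t i x} hx hit => by
    have hle : I t ≤ ⨆ j ∈ {j | j ≠ i}, I j := le_iSup₂_of_le t (show t ∈ {j | j ≠ i} from hit.symm) le_rfl
    exact Submodule.projection_apply_of_mem_right (hc i) (hle hx)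
  -- the finite set of indices in `S` with `I i ≠ 0`
  set s : Finset ι := hfin.toFinset.filter (· ∈ S) with hs
  -- `φ = Σ_{i ∈ s} φ ∘ P i`
  have hsum : ∀ x : M, φ x = ∑ i ∈ s, φ (P i x) := by
    intro x
    have hx : x ∈ ⨆ i, I i := by rw [htop]; exact Submodule.mem_top
    induction hx using Submodule.iSup_induction' with
    | mem t x hxt =>
      by_cases ht : t ∈ s
      · rw [Finset.sum_eq_single t (fun i _ hit => by rw [hP_ne hxt hit, map_zero])
          (fun h => (h ht).elim), hP_self hxt]
      · rw [Finset.sum_eq_zero fun i hi => by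
          rw [hP_ne hxt (fun h => ht (h ▸ hi)), map_zero]]
        -- `t ∉ s`: either `I t = 0` or `t ∉ S`
        rw [hs, Finset.mem_filter, Set.Finite.mem_toFinset, Set.mem_setOf_eq, not_and_or, not_not] at ht
        rcases ht with ht | ht
        · rw [ht, Submodule.mem_bot] at hxt
          rw [hxt, map_zero]
        · have hle : I t ≤ ⨆ j ∈ Sᶜ, I j := le_iSup₂_of_le t (show t ∈ Sᶜ from ht) le_rfl
          exact (Submodule.mem_dualAnnihilator φ).1 hφ x (hle hxt)
    | zero => simp
    | add x y _ _ hx hy => simp only [map_add, Finset.sum_add_distrib, hx, hy]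
  have hφeq : φ = ∑ i ∈ s, φ ∘ₗ P i := by
    refine LinearMap.ext fun x => ?_
    rw [LinearMap.sum_apply]
    exact hsum x
  rw [hφeq]
  refine Submodule.sum_mem _ fun i hi => ?_
  have hiS : i ∈ S := by
    rw [hs, Finset.mem_filter] at hi
    exact hi.2
  refine (le_iSup₂_of_le i hiS le_rfl : (⨆ j ∈ {j | j ≠ i}, I j).dualAnnihilator ≤ _) ?_
  rw [Submodule.mem_dualAnnihilator]
  intro x hx
  rw [LinearMap.comp_apply, Submodule.projection_apply_of_mem_right (hc i) hx, map_zero]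

end DualDecomposition

/-! ## §2 Transport along `ℂ ⊗ V^∨ ≅ (ℂ ⊗ V)^∨` -/

variable {V : Type u} [AddCommGroup V] [Module ℚ V] [FiniteDimensional ℚ V]

/-- Pulling back along the bijection `dualBaseChange V : ℂ ⊗ V^∨ ⥲ (ℂ ⊗ V)^∨` commutes with sums.
[folklore] -/
private theorem comap_dualBaseChange_biSup {ι : Type*} (S : Set ι) (T : ι → Submodule ℂ (Module.Dual ℂ (ℂ ⊗[ℚ] V))) :
    (⨆ i ∈ S, T i).comap (dualBaseChange V) = ⨆ i ∈ S, (T i).comap (dualBaseChange V) := by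
  let e : (ℂ ⊗[ℚ] Module.Dual ℚ V) ≃ₗ[ℂ] Module.Dual ℂ (ℂ ⊗[ℚ] V) :=
    LinearEquiv.ofBijective (dualBaseChange V) dualBaseChange_bijective
  have he : ∀ U : Submodule ℂ (Module.Dual ℂ (ℂ ⊗[ℚ] V)),
      U.comap (dualBaseChange V) = U.map (e.symm : _ →ₗ[ℂ] _) := fun U => by
    rw [← Submodule.comap_equiv_eq_map_symm]
    rfl
  simp only [he, Submodule.map_iSup]

/-- … and is monotone / reflects `≤`. [folklore] -/
private theorem comap_dualBaseChange_le_iff (T T' : Submodule ℂ (Module.Dual ℂ (ℂ ⊗[ℚ] V))) :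
    T.comap (dualBaseChange V) ≤ T'.comap (dualBaseChange V) ↔ T ≤ T' := by
  refine ⟨fun h ψ hψ => ?_, Submodule.comap_mono⟩
  obtain ⟨ξ, rfl⟩ := dualBaseChange_bijective.2 ψ
  exact h hψ

/-! ## §3 The dual bigrading and its identification with Deligne's splitting of `H^∨` -/

variable (H : MixedHodgeStructure V)

/-- **The dual bigrading `J^{p,q}(V^∨) := (⊕_{(r,s) ≠ (-p,-q)} I^{r,s}(V))^⊥`** (pulled back to
`ℂ ⊗ V^∨` along `dualBaseChange`): the linear forms on `V_ℂ` killing every Deligne piece except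
`I^{-p,-q}` — the bigrading "dual" to `I^{•,•}`. [cite: GreenGriffithsKerr2012, Prop. (I.C.2) (ii)] -/
def dualBigrading (pq : ℤ × ℤ) : Submodule ℂ (ℂ ⊗[ℚ] Module.Dual ℚ V) :=
  ((⨆ rs ∈ {rs : ℤ × ℤ | rs ≠ (-pq.1, -pq.2)}, H.deligneFamily rs).dualAnnihilator).comap (dualBaseChange V)

omit [FiniteDimensional ℚ V] in
/-- Unfolding `dualBigrading`. [cite: GreenGriffithsKerr2012, Prop. (I.C.2) (ii)] -/
theorem dualBigrading_apply (pq : ℤ × ℤ) :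
    H.dualBigrading pq =
      ((⨆ rs ∈ {rs : ℤ × ℤ | rs ≠ (-pq.1, -pq.2)}, H.deligneFamily rs).dualAnnihilator).comap
        (dualBaseChange V) :=
  rfl

/-- Sums of dual pieces: `Σ_{(p,q) ∈ S} J^{p,q}(V^∨) = (⊕_{(r,s) : (-r,-s) ∉ S} I^{r,s})^⊥` (the dual
decomposition, `biSup_dualAnnihilator_biSup_ne_eq`, re-indexed by `(p,q) ↦ (-p,-q)`). [folklore] -/
private theorem biSup_dualBigrading (S : Set (ℤ × ℤ)) :
    ⨆ pq ∈ S, H.dualBigrading pq =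
      ((⨆ rs ∈ {rs : ℤ × ℤ | (-rs.1, -rs.2) ∉ S}, H.deligneFamily rs).dualAnnihilator).comap
        (dualBaseChange V) := by
  have hre : (⨆ pq ∈ S, H.dualBigrading pq) =
      ⨆ i ∈ {i : ℤ × ℤ | (-i.1, -i.2) ∈ S},
        ((⨆ rs ∈ {rs : ℤ × ℤ | rs ≠ i}, H.deligneFamily rs).dualAnnihilator).comap (dualBaseChange V) := by
    refine le_antisymm (iSup₂_le fun pq hpq => ?_) (iSup₂_le fun i hi => ?_)
    · refine le_iSup₂_of_le (-pq.1, -pq.2) (show (-(-pq.1), -(-pq.2)) ∈ S by simpa using hpq) ?_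
      exact le_rfl
    · refine le_iSup₂_of_le (-i.1, -i.2) hi (le_of_eq ?_)
      rw [dualBigrading_apply]
      simp only [neg_neg, Prod.mk.eta]
  rw [hre, ← comap_dualBaseChange_biSup, biSup_dualAnnihilator_biSup_ne_eq H.iSupIndep_deligneFamily
    H.iSup_deligneFamily_eq_top H.finite_setOf_deligneFamily_ne_bot]
  rfl

/-- `W_n(V^∨)_ℂ = Σ_{p+q ≤ n} J^{p,q}(V^∨)`: the dual bigrading splits the dual weight filtration
(`W_n(V^∨) = (W_{-n-1})^⊥ = (⊕_{r+s ≤ -n-1} I^{r,s})^⊥`). [cite: DeligneHodgeII1971, 1.1.7] -/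
theorem baseChange_dual_W_eq_biSup_dualBigrading (n : ℤ) :
    (H.dual.W n).baseChange ℂ = ⨆ pq ∈ {pq : ℤ × ℤ | pq.1 + pq.2 ≤ n}, H.dualBigrading pq := by
  have hinner : (⨆ rs ∈ {rs : ℤ × ℤ | (-rs.1, -rs.2) ∉ {pq : ℤ × ℤ | pq.1 + pq.2 ≤ n}}, H.deligneFamily rs) =
      ⨆ (pq : ℤ × ℤ) (_ : pq.1 + pq.2 ≤ -n - 1), H.deligneFamily pq := by
    refine le_antisymm (iSup₂_le fun rs hrs => le_iSup₂_of_le rs ?_ le_rfl)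
      (iSup₂_le fun rs hrs => le_iSup₂_of_le rs ?_ le_rfl)
    · simp only [Set.mem_setOf_eq] at hrs
      omega
    · simp only [Set.mem_setOf_eq]
      omega
  rw [biSup_dualBigrading, baseChange_dual_W, H.baseChange_W_eq_biSup_deligneFamily (-n - 1), hinner]

/-- `F^p(V^∨) = Σ_{a ≥ p} J^{a,b}(V^∨)` (`F^p(V^∨) = (F^{1-p})^⊥ = (⊕_{r ≥ 1-p} I^{r,s})^⊥`).
[cite: DeligneHodgeII1971, 1.1.7] -/
theorem dual_F_eq_biSup_dualBigrading (p : ℤ) :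
    H.dual.F p = ⨆ pq ∈ {pq : ℤ × ℤ | p ≤ pq.1}, H.dualBigrading pq := by
  have hinner : (⨆ rs ∈ {rs : ℤ × ℤ | (-rs.1, -rs.2) ∉ {pq : ℤ × ℤ | p ≤ pq.1}}, H.deligneFamily rs) =
      ⨆ (pq : ℤ × ℤ) (_ : 1 - p ≤ pq.1), H.deligneFamily pq := by
    refine le_antisymm (iSup₂_le fun rs hrs => le_iSup₂_of_le rs ?_ le_rfl)
      (iSup₂_le fun rs hrs => le_iSup₂_of_le rs ?_ le_rfl)
    · simp only [Set.mem_setOf_eq] at hrs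
      omega
    · simp only [Set.mem_setOf_eq]
      omega
  rw [biSup_dualBigrading, dual_F, H.F_eq_biSup_deligneFamily (1 - p), hinner]

/-- The dual bigrading satisfies the congruence (7.5.11) for `V^∨`:
`conj J^{p,q} ⊆ J^{q,p} ⊕ ⊕_{r<q, s<p} J^{r,s}` — dual to the congruence for `I^{•,•}(V)`
(`complexConj_deligneI_le_deligneI_sup_biSup`). [cite: CattaniElZeinGriffithsLe2014, Thm. 7.5.6 (7.5.11)] -/
theorem complexConj_dualBigrading_le (p q : ℤ) :
    complexConj (H.dualBigrading (p, q)) ≤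
      H.dualBigrading (q, p) ⊔ ⨆ pq ∈ {pq : ℤ × ℤ | pq.1 < q ∧ pq.2 < p}, H.dualBigrading pq := by
  have hrhs : H.dualBigrading (q, p) ⊔ ⨆ pq ∈ {pq : ℤ × ℤ | pq.1 < q ∧ pq.2 < p}, H.dualBigrading pq =
      ⨆ pq ∈ ({(q, p)} : Set (ℤ × ℤ)) ∪ {pq : ℤ × ℤ | pq.1 < q ∧ pq.2 < p}, H.dualBigrading pq := by
    rw [iSup_union, iSup_singleton]
  rw [hrhs, biSup_dualBigrading, dualBigrading_apply, complexConj_comap_dualAnnihilator,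
    comap_dualBaseChange_le_iff]
  refine Submodule.dualAnnihilator_anti (iSup₂_le fun rs hrs => ?_)
  -- `rs = (r, s)` with `(-r,-s) ≠ (q,p)` and `¬(-r < q ∧ -s < p)`; show `I^{r,s} ⊆ conj (⊕_{≠(-p,-q)} I)`
  simp only [Set.mem_setOf_eq, Set.mem_union, Set.mem_singleton_iff, Prod.ext_iff, not_or, not_and_or,
    not_lt] at hrs
  intro x hx
  rw [HodgeStructure.mem_complexConj]
  have hcx : HodgeStructure.conj x ∈ complexConj (H.deligneI rs.1 rs.2) := by
    rw [HodgeStructure.mem_complexConj, HodgeStructure.conj_conj]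
    exact hx
  refine (H.complexConj_deligneI_le_deligneI_sup_biSup rs.2 rs.1).trans ?_ hcx
  refine sup_le (le_iSup₂_of_le (rs.2, rs.1) ?_ (by rw [deligneFamily_apply])) (iSup₂_le fun cd hcd =>
    le_iSup₂_of_le cd ?_ le_rfl)
  · simp only [Set.mem_setOf_eq, ne_eq, Prod.ext_iff, not_and_or]
    omega
  · simp only [Set.mem_setOf_eq, ne_eq, Prod.ext_iff, not_and_or] at hcd ⊢
    omega

/-- **Deligne's splitting of the dual MHS is the dual bigrading:
`I^{p,q}(V^∨) = (⊕_{(r,s) ≠ (-p,-q)} I^{r,s}(V))^⊥`** — "`V^{•,•}` is compatible with … dual"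
(Green–Griffiths–Kerr, Prop. (I.C.2) (ii)), obtained from the uniqueness of Deligne's splitting
(`eq_deligneI_of_splitting`) applied to the dual bigrading, which splits `W(V^∨)` and `F(V^∨)` and satisfies
the congruence (7.5.11). [cite: GreenGriffithsKerr2012, Prop. (I.C.2) (ii)] [cite: CattaniElZeinGriffithsLe2014, Thm. 7.5.6 and §3.2.2.7] -/
theorem dual_deligneI (p q : ℤ) :
    H.dual.deligneI p q =
      ((⨆ rs ∈ {rs : ℤ × ℤ | rs ≠ (-p, -q)}, H.deligneFamily rs).dualAnnihilator).comap (dualBaseChange V) :=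
  (eq_deligneI_of_splitting H.dual H.dualBigrading H.baseChange_dual_W_eq_biSup_dualBigrading
    H.dual_F_eq_biSup_dualBigrading H.complexConj_dualBigrading_le p q).symm

/-- Membership form: **`ξ ∈ I^{p,q}(V^∨)` iff `ξ` (as a linear form on `V_ℂ`) kills `I^{r,s}(V)` for every
`(r,s) ≠ (-p,-q)`**. [cite: GreenGriffithsKerr2012, Prop. (I.C.2) (ii)] -/
theorem mem_dual_deligneI_iff (p q : ℤ) (ξ : ℂ ⊗[ℚ] Module.Dual ℚ V) :
    ξ ∈ H.dual.deligneI p q ↔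
      ∀ r s : ℤ, (r, s) ≠ (-p, -q) → ∀ x ∈ H.deligneI r s, dualBaseChange V ξ x = 0 := by
  rw [dual_deligneI, Submodule.mem_comap, Submodule.mem_dualAnnihilator]
  constructor
  · intro h r s hrs x hx
    exact h x ((le_iSup₂_of_le (r, s) hrs le_rfl : H.deligneFamily (r, s) ≤ _) hx)
  · intro h x hx
    induction hx using Submodule.iSup_induction' with
    | mem rs x hxrs =>
      induction hxrs using Submodule.iSup_induction' with
      | mem hrs x hx => exact h rs.1 rs.2 hrs x hx
      | zero => exact map_zero _
      | add x y _ _ hx hy => rw [map_add, hx, hy, add_zero]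
    | zero => exact map_zero _
    | add x y _ _ hx hy => rw [map_add, hx, hy, add_zero]

/-- `I^{p,q}(V^∨)` pairs trivially with `I^{r,s}(V)` unless `(r,s) = (-p,-q)`.
[cite: GreenGriffithsKerr2012, Prop. (I.C.2) (ii)] -/
theorem dualBaseChange_apply_eq_zero_of_mem_deligneI {p q r s : ℤ} (hrs : (r, s) ≠ (-p, -q))
    {ξ : ℂ ⊗[ℚ] Module.Dual ℚ V} (hξ : ξ ∈ H.dual.deligneI p q) {x : ℂ ⊗[ℚ] V} (hx : x ∈ H.deligneI r s) :
    dualBaseChange V ξ x = 0 :=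
  (H.mem_dual_deligneI_iff p q ξ).1 hξ r s hrs x hx

/-- **The dual of a mixed Hodge structure split over `ℝ` is split over `ℝ`.**
[cite: CattaniElZeinGriffithsLe2014, Def. 7.5.7 and §3.2.2.7] -/
theorem complexConj_dual_deligneI_of_forall (h : ∀ p q : ℤ, complexConj (H.deligneI p q) = H.deligneI q p)
    (p q : ℤ) : complexConj (H.dual.deligneI p q) = H.dual.deligneI q p := by
  rw [dual_deligneI, dual_deligneI, complexConj_comap_dualAnnihilator]
  congr 2
  have hsup := (HodgeStructure.complexConjOrderIso (V := V)).map_iSup₂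
    fun (rs : ℤ × ℤ) (_ : rs ∈ {rs : ℤ × ℤ | rs ≠ (-p, -q)}) => H.deligneFamily rs
  simp only [HodgeStructure.complexConjOrderIso_apply] at hsup
  rw [hsup]
  refine le_antisymm (iSup₂_le fun rs hrs => ?_) (iSup₂_le fun rs hrs => ?_)
  · rw [deligneFamily_apply, h rs.1 rs.2]
    refine le_iSup₂_of_le (rs.2, rs.1) ?_ (by rw [deligneFamily_apply])
    simp only [Set.mem_setOf_eq, ne_eq, Prod.ext_iff, not_and_or] at hrs ⊢
    omega
  · refine le_iSup₂_of_le (rs.2, rs.1) ?_ ?_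
    · simp only [Set.mem_setOf_eq, ne_eq, Prod.ext_iff, not_and_or] at hrs ⊢
      omega
    · rw [deligneFamily_apply, deligneFamily_apply, h rs.2 rs.1]

end MixedHodgeStructure

end Literature.AlgebraicGeometry.Motives

end
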